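import Mathlib
import Literature.Analysis.FluidPDE.SuitableWeakStability
import HarnessLib

/-!
# Vanishing-viscosity limits of suitable weak Navier–Stokes solutions are suitable weak Euler solutions
# (route №10 `EulerZoomLiouville`, support item Z = stmt-NavierStokesRegularity-19834 `SereginZoomReduction`)

Helper file (theorems only; `--supports stmt-NavierStokesRegularity-19834`). Seat ns-typeII-p2 g3 (cell
ns-regularity-ideate §B, D-0081), brick «VanishingViscosity» of ns-typeII-p3 g3's plan for the kernel port
of Seregin's Euler-zoom compactness theorem (arXiv:2606.29468 Thm 3.1 = arXiv:2304.04045 Prop 1.2): the zooms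
`v_k(s,y) = r_k^{1+ρ} v(t₀ + r_k^{2+ρ} s, x₀ + r_k y)` of a suitable weak Navier–Stokes solution are suitable
weak solutions with VISCOSITIES `ν_k = r_k^ρ → 0`, and the compactness step needs the stability of the class
along such a sequence, with an Euler (`ν = 0`) limit.

* `isSuitableWeakSolutionOn_of_tendsto_viscosity` — the tree's stability theorem
  `Literature.Analysis.FluidPDE.isSuitableWeakSolutionOn_of_tendsto` (Caffarelli–Kohn–Nirenberg 1982 §2;
  Lin 1998 Thm 2.2; Bradshaw–Tsai 2019 §4.3) with the viscosity allowed to VARY along the sequence: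
  on an open space–time region `Q` of finite measure let `(v_k, π_k)` be suitable weak solutions with
  viscosities `ν_k ≥ 0`, `ν_k → ν₀`, no force, weak spatial gradients `G_k`, `v_k ∈ L³(Q)`,
  `∫_Q |π_k|^{3/2} ≤ C_p`; if `v_k → u` in `L³(Q)`, `π_k ⇀ p` weakly in `L^{3/2}(Q)`, `G_k a ⇀ G a` weakly in
  `L²(Q)` for every direction `a` (`G` a weak spatial gradient of `u`, `∫_Q |G|² < ∞`), `∫_Q |p|^{3/2} ≤ C_p`
  and `u ∈ L^∞_t L²_x` locally, then `(u, p)` is a suitable weak solution on `Q` WITH VISCOSITY `ν₀` (for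
  `ν₀ = 0`: a suitable weak EULER solution — distributional Euler equations, the classes, and the local
  energy inequality `0 ≤ ∫∫ (|u|² ∂ₜφ + (|u|² + 2p) u·∇φ)`).
  Proof = the tree proof with two extra limits: the viscous pairing `ν_k ∫⟪v_k, Δψ⟫ → ν₀ ∫⟪u, Δψ⟫` and the
  correction `(ν_k − ν₀) ∫ |v_k|² Δφ → 0` on the right-hand side of the local energy inequality; the
  left-hand side `2ν_k ∫|G_k|²φ` is handled by weak lower semicontinuity against `2(ν₀ − ε)` for every
  `ε > 0` (trivial when `ν₀ = 0`).
* `isSuitableWeakSolutionOn_euler_of_tendsto_viscosity` — the case `ν_k → 0` spelled out.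

WHAT THIS IS NOT: not NS regularity, not Seregin's theorem — one stability brick for its port. [folklore]
-/

noncomputable section

-- the summit and its single problem share the name `NavierStokesRegularity` (D-0017 nested layout)
set_option linter.dupNamespace false

open Set Function Filter Topology MeasureTheory Metric TopologicalSpace
open scoped NNReal ENNReal InnerProductSpace RealInnerProductSpace Laplacian

namespace Summit.NavierStokesRegularity.NavierStokesRegularity.Theorems.SereginZoomReduction

open Literature.Analysis Literature.Analysis.FunctionSpaces Literature.Analysis.FluidPDE

variable {E : Type*} [NormedAddCommGroup E] [InnerProductSpace ℝ E] [FiniteDimensional ℝ E]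
  [MeasurableSpace E] [BorelSpace E]

/-- **Vanishing-viscosity stability of suitable weak solutions.**  On an open space–time region `Q` of
finite measure let `(v_k, π_k)` be suitable weak Navier–Stokes solutions with viscosities `ν_k ≥ 0`,
`ν_k → ν₀`, no force, weak spatial gradients `G_k`, `v_k ∈ L³(Q)` and `∫_Q |π_k|^{3/2} ≤ C_p`.  If
`v_k → u` in `L³(Q)`, `π_k ⇀ p` weakly in `L^{3/2}(Q)` (pairings with `L³(Q)` converge) with
`∫_Q |p|^{3/2} ≤ C_p`, `G_k a ⇀ G a` weakly in `L²(Q; E)` for every direction `a` where `G` is a weak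
spatial gradient of `u` on `Q` with `∫_Q |G|² < ∞`, and `u ∈ L^∞_t L²_x` on compact subsets of `Q`, then
`(u, p)` is a suitable weak solution on `Q` with viscosity `ν₀` (in particular a suitable weak Euler
solution when `ν_k → 0`).  The tree's `isSuitableWeakSolutionOn_of_tendsto` is the constant case
`ν_k ≡ ν`. [cite: BradshawTsai2019, §4.3 (proof of Thm 1.2)] [cite: CaffarelliKohnNirenberg1982, §2 (2.5)] -/
theorem isSuitableWeakSolutionOn_of_tendsto_viscosity {Q : Opens (ℝ × E)}
    (hQ : volume (Q : Set (ℝ × E)) ≠ ∞) {ν : ℕ → ℝ} {ν₀ : ℝ} (hν : ∀ k, 0 ≤ ν k)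
    (hνlim : Tendsto ν atTop (𝓝 ν₀))
    {v : ℕ → ℝ → E → E} {π : ℕ → ℝ → E → ℝ} {G : ℕ → ℝ → E → E →L[ℝ] E}
    {u : ℝ → E → E} {p : ℝ → E → ℝ} {Gu : ℝ → E → E →L[ℝ] E} {Cp : ℝ≥0∞} (hCp : Cp ≠ ∞)
    (hsol : ∀ k, IsSuitableWeakSolutionOn Q (ν k) 0 (v k) (π k))
    (hG : ∀ k, HasWeakSpatialGradientOn Q (v k) (G k))
    (hv3 : ∀ k, MemLp (uncurry (v k)) 3 (volume.restrict (Q : Set (ℝ × E))))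
    (hπb : ∀ k, ∫⁻ z in (Q : Set (ℝ × E)), ‖π k z.1 z.2‖ₑ ^ (3 / 2 : ℝ) ≤ Cp)
    (hu3 : MemLp (uncurry u) 3 (volume.restrict (Q : Set (ℝ × E))))
    (hpm : AEStronglyMeasurable (uncurry p) (volume.restrict (Q : Set (ℝ × E))))
    (hpb : ∫⁻ z in (Q : Set (ℝ × E)), ‖p z.1 z.2‖ₑ ^ (3 / 2 : ℝ) ≤ Cp)
    (hGu : HasWeakSpatialGradientOn Q u Gu)
    (hGu2 : ∫⁻ z in (Q : Set (ℝ × E)), ENNReal.ofReal (frobeniusNormSq (Gu z.1 z.2)) < ∞)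
    (huE : ∀ K ⊆ (Q : Set (ℝ × E)), IsCompact K → ∃ C : ℝ≥0, ∀ᵐ t : ℝ,
      ∫⁻ x, K.indicator (fun z : ℝ × E => ‖u z.1 z.2‖ₑ ^ 2) (t, x) ≤ C)
    (hconv : Tendsto (fun k => eLpNorm (uncurry (v k) - uncurry u) 3
      (volume.restrict (Q : Set (ℝ × E)))) atTop (𝓝 0))
    (hπw : ∀ g : ℝ × E → ℝ, MemLp g 3 (volume.restrict (Q : Set (ℝ × E))) →
      Tendsto (fun k => ∫ z in (Q : Set (ℝ × E)), π k z.1 z.2 * g z) atTop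
        (𝓝 (∫ z in (Q : Set (ℝ × E)), p z.1 z.2 * g z)))
    (hGw : ∀ (a : E) (h : ℝ × E → E), MemLp h 2 (volume.restrict (Q : Set (ℝ × E))) →
      Tendsto (fun k => ∫ z in (Q : Set (ℝ × E)), ⟪G k z.1 z.2 a, h z⟫) atTop
        (𝓝 (∫ z in (Q : Set (ℝ × E)), ⟪Gu z.1 z.2 a, h z⟫))) :
    IsSuitableWeakSolutionOn Q ν₀ 0 u p := by
  set S : Set (ℝ × E) := (Q : Set (ℝ × E)) with hS
  have hSm : MeasurableSet S := Q.isOpen.measurableSet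
  set μQ : Measure (ℝ × E) := volume.restrict S with hμQ
  haveI : IsFiniteMeasure μQ := ⟨by rw [hμQ, Measure.restrict_apply_univ]; exact hQ.lt_top⟩
  have h13 : (1 : ℝ≥0∞) ≤ 3 := by norm_num
  have h23 : (2 : ℝ≥0∞) ≤ 3 := by norm_num
  have h132 : (1 : ℝ≥0∞) ≤ 3 / 2 := FunctionSpaces.ennreal_one_le_three_halves
  -- memberships
  have hv2 : ∀ k, MemLp (uncurry (v k)) 2 μQ := fun k => (hv3 k).mono_exponent h23
  have hu2 : MemLp (uncurry u) 2 μQ := hu3.mono_exponent h23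
  have hu1 : Integrable (uncurry u) μQ := hu3.integrable h13
  have hconv2 : Tendsto (fun k => eLpNorm (uncurry (v k) - uncurry u) 2 μQ) atTop (𝓝 0) :=
    tendsto_eLpNorm_two_of_three (fun k => (hv3 k).1.sub hu3.1) hconv
  have hπm : ∀ k, AEStronglyMeasurable (uncurry (π k)) μQ := fun k =>
    (hsol k).distributional.2.2.1.aestronglyMeasurable
  have hπmem : ∀ k, MemLp (uncurry (π k)) (3 / 2) μQ ∧
      eLpNorm (uncurry (π k)) (3 / 2) μQ ≤ Cp ^ (1 / (3 / 2 : ℝ)) := fun k =>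
    memLp_threeHalves_of_lintegral_le (hπm k) hCp (hπb k)
  have hpmem := memLp_threeHalves_of_lintegral_le hpm hCp hpb
  have hMt : Cp ^ (1 / (3 / 2 : ℝ)) ≠ ⊤ := ENNReal.rpow_ne_top_of_nonneg (by norm_num) hCp
  have hp1 : Integrable (uncurry p) μQ := hpmem.1.integrable h132
  have hπ1 : ∀ k, Integrable (uncurry (π k)) μQ := fun k => (hπmem k).1.integrable h132
  ------------------------------------------------------------------
  -- (1) the distributional equations
  ------------------------------------------------------------------
  have hdist : IsDistributionalNSSolutionOn Q ν₀ 0 u p := by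
    refine ⟨IntegrableOn.locallyIntegrableOn hu1, ?_, IntegrableOn.locallyIntegrableOn hp1,
      fun θ hθ => ?_, fun ψ hψ => ?_⟩
    · exact IntegrableOn.locallyIntegrableOn ((memLp_two_iff_integrable_sq_norm hu2.1).1 hu2)
    · -- divergence free
      obtain ⟨C, hC0, -, -, hgC, -⟩ := hθ.exists_scalar_weights_bound
      have hw : AEStronglyMeasurable (fun z : ℝ × E => gradient (θ z.1) z.2) μQ :=
        hθ.continuous_slice_gradient.aestronglyMeasurable
      have hlim : Tendsto (fun k => ∫ z, ⟪uncurry (v k) z, gradient (θ z.1) z.2⟫ ∂μQ) atTop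
          (𝓝 (∫ z, ⟪uncurry u z, gradient (θ z.1) z.2⟫ ∂μQ)) :=
        tendsto_integral_inner_of_tendsto_eLpNorm_two_bdd hv2 hu2 hconv2 hw hC0 hgC
      have h0 : ∀ k, ∫ z, ⟪uncurry (v k) z, gradient (θ z.1) z.2⟫ ∂μQ = 0 := fun k =>
        (hsol k).distributional.2.2.2.1 θ hθ
      simp only [h0] at hlim
      exact (tendsto_nhds_unique tendsto_const_nhds hlim).symm
    · -- the momentum equation
      obtain ⟨C, hC0, htC, hDC, hΔC, hdivC⟩ := hψ.exists_weights_bound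
      have htm : AEStronglyMeasurable (fun z : ℝ × E => timeDeriv ψ z.1 z.2) μQ :=
        hψ.continuous_timeDeriv.aestronglyMeasurable
      have hDm : AEStronglyMeasurable (fun z : ℝ × E => fderiv ℝ (ψ z.1) z.2) μQ :=
        hψ.continuous_fderiv_slice.aestronglyMeasurable
      have hΔm : AEStronglyMeasurable (fun z : ℝ × E => Δ (ψ z.1) z.2) μQ :=
        hψ.continuous_laplacian_slice.aestronglyMeasurable
      have hdivm : AEStronglyMeasurable (fun z : ℝ × E => VectorCalculus.divergence (ψ z.1) z.2) μQ :=
        hψ.continuous_divergence_slice.aestronglyMeasurable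
      have hdiv3 : MemLp (fun z : ℝ × E => VectorCalculus.divergence (ψ z.1) z.2) 3 μQ :=
        (memLp_top_of_bound hdivm C (Eventually.of_forall hdivC)).mono_exponent le_top
      have happ : Continuous (uncurry fun (T : E →L[ℝ] E) (x : E) => T x) :=
        isBoundedBilinearMap_apply.continuous
      -- splitting of the tested integrand
      have hsplit : ∀ (ν' : ℝ) {w : ℝ → E → E} {q : ℝ → E → ℝ}, MemLp (uncurry w) 2 μQ →
          Integrable (uncurry q) μQ →
          ∫ z, (⟪w z.1 z.2, timeDeriv ψ z.1 z.2⟫ + ⟪w z.1 z.2, convect (w z.1) (ψ z.1) z.2⟫ +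
            ν' * ⟪w z.1 z.2, Δ (ψ z.1) z.2⟫ + q z.1 z.2 * VectorCalculus.divergence (ψ z.1) z.2 +
            ⟪(0 : ℝ → E → E) z.1 z.2, ψ z.1 z.2⟫) ∂μQ =
          ((∫ z, ⟪uncurry w z, timeDeriv ψ z.1 z.2⟫ ∂μQ) +
            ∫ z, ⟪uncurry w z, fderiv ℝ (ψ z.1) z.2 (uncurry w z)⟫ ∂μQ) +
          (ν' * ∫ z, ⟪uncurry w z, Δ (ψ z.1) z.2⟫ ∂μQ +
            ∫ z, uncurry q z * VectorCalculus.divergence (ψ z.1) z.2 ∂μQ) := by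
        intro ν' w q hw hq
        have hw1 : Integrable (uncurry w) μQ := hw.integrable one_le_two
        have hbd : ∀ {g : ℝ × E → E}, AEStronglyMeasurable g μQ → (∀ z, ‖g z‖ ≤ C) →
            Integrable (fun z => ⟪uncurry w z, g z⟫) μQ := fun {g} hg hgC => by
          refine (hw1.norm.mul_const C).mono' (hw.1.inner hg) (Eventually.of_forall fun z => ?_)
          exact (norm_inner_le_norm _ _).trans (mul_le_mul_of_nonneg_left (hgC z) (norm_nonneg _))
        have i1 := hbd htm htC
        have i2 : Integrable (fun z => ⟪uncurry w z, fderiv ℝ (ψ z.1) z.2 (uncurry w z)⟫) μQ := by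
          have hm : AEStronglyMeasurable (fun z => fderiv ℝ (ψ z.1) z.2 (uncurry w z)) μQ :=
            happ.comp_aestronglyMeasurable₂ hDm hw.1
          have h2 : Integrable (fun z => ‖uncurry w z‖ ^ 2) μQ :=
            (memLp_two_iff_integrable_sq_norm hw.1).1 hw
          refine (h2.const_mul C).mono' (hw.1.inner hm) (Eventually.of_forall fun z => ?_)
          calc ‖⟪uncurry w z, fderiv ℝ (ψ z.1) z.2 (uncurry w z)⟫‖
              ≤ ‖uncurry w z‖ * ‖fderiv ℝ (ψ z.1) z.2 (uncurry w z)‖ := norm_inner_le_norm _ _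
            _ ≤ ‖uncurry w z‖ * (C * ‖uncurry w z‖) := by
                gcongr
                exact (ContinuousLinearMap.le_opNorm _ _).trans
                  (mul_le_mul_of_nonneg_right (hDC z) (norm_nonneg _))
            _ = C * ‖uncurry w z‖ ^ 2 := by ring
        have i3 : Integrable (fun z => ν' * ⟪uncurry w z, Δ (ψ z.1) z.2⟫) μQ := (hbd hΔm hΔC).const_mul ν'
        have i4 : Integrable (fun z => uncurry q z * VectorCalculus.divergence (ψ z.1) z.2) μQ :=
          (hq.bdd_mul hdivm (Eventually.of_forall hdivC)).congr
            (Eventually.of_forall fun z => mul_comm _ _)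
        have i12 : Integrable (fun z => ⟪uncurry w z, timeDeriv ψ z.1 z.2⟫ +
            ⟪uncurry w z, fderiv ℝ (ψ z.1) z.2 (uncurry w z)⟫) μQ := i1.add i2
        have i34 : Integrable (fun z => ν' * ⟪uncurry w z, Δ (ψ z.1) z.2⟫ +
            uncurry q z * VectorCalculus.divergence (ψ z.1) z.2) μQ := i3.add i4
        have e1 := integral_add i1 i2
        have e2 := integral_add i3 i4
        have e12 := integral_add i12 i34
        have e3 := integral_const_mul (μ := μQ) ν' (fun z : ℝ × E => ⟪uncurry w z, Δ (ψ z.1) z.2⟫)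
        rw [← e3, ← e1, ← e2, ← e12]
        refine integral_congr_ae (Eventually.of_forall fun z => ?_)
        simp only [convect, uncurry, Pi.zero_apply, inner_zero_left, add_zero]
        ring
      -- the limits of the four pieces
      have hl1 : Tendsto (fun k => ∫ z, ⟪uncurry (v k) z, timeDeriv ψ z.1 z.2⟫ ∂μQ) atTop
          (𝓝 (∫ z, ⟪uncurry u z, timeDeriv ψ z.1 z.2⟫ ∂μQ)) :=
        tendsto_integral_inner_of_tendsto_eLpNorm_two_bdd hv2 hu2 hconv2 htm hC0 htC
      have hl2 : Tendsto (fun k => ∫ z, ⟪uncurry (v k) z, fderiv ℝ (ψ z.1) z.2 (uncurry (v k) z)⟫ ∂μQ)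
          atTop (𝓝 (∫ z, ⟪uncurry u z, fderiv ℝ (ψ z.1) z.2 (uncurry u z)⟫ ∂μQ)) :=
        tendsto_integral_inner_clm_apply_of_tendsto_eLpNorm hv2 hu2 hconv2 hDm hC0 hDC
      have hl3 : Tendsto (fun k => ν k * ∫ z, ⟪uncurry (v k) z, Δ (ψ z.1) z.2⟫ ∂μQ) atTop
          (𝓝 (ν₀ * ∫ z, ⟪uncurry u z, Δ (ψ z.1) z.2⟫ ∂μQ)) :=
        hνlim.mul (tendsto_integral_inner_of_tendsto_eLpNorm_two_bdd hv2 hu2 hconv2 hΔm hC0 hΔC)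
      have hl4 : Tendsto (fun k => ∫ z, uncurry (π k) z * VectorCalculus.divergence (ψ z.1) z.2 ∂μQ)
          atTop (𝓝 (∫ z, uncurry p z * VectorCalculus.divergence (ψ z.1) z.2 ∂μQ)) :=
        hπw _ hdiv3
      have hlim := (hl1.add hl2).add (hl3.add hl4)
      have hk : ∀ k, ((∫ z, ⟪uncurry (v k) z, timeDeriv ψ z.1 z.2⟫ ∂μQ) +
          ∫ z, ⟪uncurry (v k) z, fderiv ℝ (ψ z.1) z.2 (uncurry (v k) z)⟫ ∂μQ) +
          (ν k * ∫ z, ⟪uncurry (v k) z, Δ (ψ z.1) z.2⟫ ∂μQ +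
            ∫ z, uncurry (π k) z * VectorCalculus.divergence (ψ z.1) z.2 ∂μQ) = 0 := fun k => by
        rw [← hsplit (ν k) (hv2 k) (hπ1 k)]
        exact (hsol k).distributional.2.2.2.2 ψ hψ
      simp only [hk] at hlim
      have h := tendsto_nhds_unique tendsto_const_nhds hlim
      rw [hsplit ν₀ hu2 hp1]
      exact h.symm
  ------------------------------------------------------------------
  -- (2)–(4) the classes and the local energy inequality
  ------------------------------------------------------------------
  refine
    { distributional := hdist
      energyClass := huE
      pressure := fun K hK _ => (lintegral_mono_set hK).trans_lt (hpb.trans_lt hCp.lt_top)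
      localEnergy := ⟨Gu, hGu, fun K hK _ => (lintegral_mono_set hK).trans_lt hGu2, ?_⟩ }
  intro φ hφ hφ0
  obtain ⟨C, hC0, hφC, -, -, -⟩ := hφ.exists_scalar_weights_bound
  -- the local energy inequalities of the `vₖ`, in set-integral form with the gradients `Gₖ`
  have hk := fun k => (hsol k).setIntegral_localEnergy hQ (hG k) (hv3 k) (hπmem k).1 hφ hφ0
  -- convergence of the right-hand sides at the FIXED viscosity `ν₀` …
  have hRlim := tendsto_setIntegral_lei_rhs (μ := μQ) ν₀ hφ hMt hv3 hu3 hconv hπm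
    (fun k => (hπmem k).2) hpmem.1 hπw
  set Ru : ℝ := ∫ z, (‖u z.1 z.2‖ ^ 2 * (timeDeriv φ z.1 z.2 + ν₀ * Δ (φ z.1) z.2) +
    (‖u z.1 z.2‖ ^ 2 + 2 * p z.1 z.2) * ⟪u z.1 z.2, gradient (φ z.1) z.2⟫) ∂μQ with hRu
  -- … and the correction `(ν k - ν₀) ∫ Δφ ‖v k‖²`, which tends to `0`
  obtain ⟨Cφ, hCφ0, -, -, -, hΔCφ⟩ := hφ.exists_scalar_weights_bound
  have hΔφm : AEStronglyMeasurable (fun z : ℝ × E => Δ (φ z.1) z.2) μQ :=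
    hφ.continuous_laplacian_slice.aestronglyMeasurable
  set A : ℕ → ℝ := fun k => ∫ z, Δ (φ z.1) z.2 * ‖v k z.1 z.2‖ ^ 2 ∂μQ with hA
  have hAlim : Tendsto A atTop (𝓝 (∫ z, Δ (φ z.1) z.2 * ‖u z.1 z.2‖ ^ 2 ∂μQ)) :=
    FunctionSpaces.tendsto_integral_mul_norm_sq (μ := μQ) (fun k => (hv3 k).1) hu2 hconv2 hΔφm
      hCφ0 hΔCφ
  have hcorr : Tendsto (fun k => (ν k - ν₀) * A k) atTop (𝓝 0) := by
    have h1 : Tendsto (fun k => ν k - ν₀) atTop (𝓝 0) := by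
      simpa using hνlim.sub_const ν₀
    simpa using h1.mul hAlim
  -- the right-hand sides at the viscosities `ν k`, and their decomposition
  set R : ℕ → ℝ := fun k => ∫ z, (‖v k z.1 z.2‖ ^ 2 * (timeDeriv φ z.1 z.2 + ν k * Δ (φ z.1) z.2) +
    (‖v k z.1 z.2‖ ^ 2 + 2 * π k z.1 z.2) * ⟪v k z.1 z.2, gradient (φ z.1) z.2⟫) ∂μQ with hRdef
  have hRsplit : ∀ k, R k = (∫ z, (‖v k z.1 z.2‖ ^ 2 * (timeDeriv φ z.1 z.2 + ν₀ * Δ (φ z.1) z.2) +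
      (‖v k z.1 z.2‖ ^ 2 + 2 * π k z.1 z.2) * ⟪v k z.1 z.2, gradient (φ z.1) z.2⟫) ∂μQ) +
      (ν k - ν₀) * A k := by
    intro k
    obtain ⟨iA, iB, iC⟩ := integrable_lei_pieces (μ := μQ) ν₀ hφ (hv3 k) (hπmem k).1
    have i1 : Integrable (fun z : ℝ × E => ‖v k z.1 z.2‖ ^ 2 * (timeDeriv φ z.1 z.2 +
        ν₀ * Δ (φ z.1) z.2) + (‖v k z.1 z.2‖ ^ 2 + 2 * π k z.1 z.2) *
        ⟪v k z.1 z.2, gradient (φ z.1) z.2⟫) μQ := by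
      have h := iA.add (iB.add (iC.const_mul 2))
      refine h.congr (Eventually.of_forall fun z => ?_)
      simp only [Pi.add_apply]
      ring
    have hsq : Integrable (fun z : ℝ × E => ‖v k z.1 z.2‖ ^ 2) μQ :=
      (memLp_two_iff_integrable_sq_norm (hv2 k).1).1 (hv2 k)
    have i2 : Integrable (fun z : ℝ × E => Δ (φ z.1) z.2 * ‖v k z.1 z.2‖ ^ 2) μQ := by
      have h := hsq.bdd_mul hΔφm (c := Cφ) (Eventually.of_forall hΔCφ)
      exact h
    have i3 : Integrable (fun z : ℝ × E => (ν k - ν₀) * (Δ (φ z.1) z.2 * ‖v k z.1 z.2‖ ^ 2)) μQ :=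
      i2.const_mul _
    have e1 := integral_add i1 i3
    have e2 := integral_const_mul (μ := μQ) (ν k - ν₀)
      (fun z : ℝ × E => Δ (φ z.1) z.2 * ‖v k z.1 z.2‖ ^ 2)
    simp only [hRdef, hA]
    rw [← e2, ← e1]
    refine integral_congr_ae (Eventually.of_forall fun z => ?_)
    ring
  have hR : Tendsto R atTop (𝓝 Ru) := by
    have h := hRlim.add hcorr
    rw [add_zero] at h
    refine h.congr fun k => ?_
    rw [hRsplit k]
  -- `|Gu|² φ` is integrable on `Q`
  have hGum : AEStronglyMeasurable (uncurry Gu) μQ := hGu.locallyIntegrableOn_grad.aestronglyMeasurable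
  have hGm : ∀ k, AEStronglyMeasurable (uncurry (G k)) μQ := fun k =>
    (hG k).locallyIntegrableOn_grad.aestronglyMeasurable
  have hφm : AEStronglyMeasurable (uncurry φ) μQ := hφ.contDiff.continuous.aestronglyMeasurable
  have hfrobm : AEStronglyMeasurable (fun z : ℝ × E => frobeniusNormSq (Gu z.1 z.2)) μQ :=
    LerayHopfProofs.continuous_frobeniusNormSq.comp_aestronglyMeasurable hGum
  have hIGu : IntegrableOn (fun z : ℝ × E => frobeniusNormSq (Gu z.1 z.2) * φ z.1 z.2) S volume := by
    have hf : Integrable (fun z : ℝ × E => frobeniusNormSq (Gu z.1 z.2)) μQ := by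
      refine ⟨hfrobm, ?_⟩
      rw [hasFiniteIntegral_iff_enorm]
      refine lt_of_le_of_lt (lintegral_mono fun z => ?_) hGu2
      rw [Real.enorm_eq_ofReal (frobeniusNormSq_nonneg _)]
    refine (hf.mul_const C).mono' (hfrobm.mul hφm) (Eventually.of_forall fun z => ?_)
    rw [norm_mul, Real.norm_of_nonneg (frobeniusNormSq_nonneg _)]
    exact mul_le_mul_of_nonneg_left (hφC z) (frobeniusNormSq_nonneg _)
  -- pass to set integrals
  rw [integral_integral_frobeniusNormSq_mul_eq hφ hIGu, integral_integral_lei_rhs_eq hQ ν₀ hu3 hpmem.1 hφ]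
  change 2 * ν₀ * ∫ z, frobeniusNormSq (Gu z.1 z.2) * φ z.1 z.2 ∂μQ ≤ Ru
  -- nonnegativity of the right-hand sides
  have hRk0 : ∀ k, 0 ≤ R k := fun k => by
    refine le_trans ?_ (hk k).2
    exact mul_nonneg (mul_nonneg zero_le_two (hν k))
      (integral_nonneg fun z => mul_nonneg (frobeniusNormSq_nonneg _) (hφ0 _ _))
  have hRu0 : 0 ≤ Ru := ge_of_tendsto' hR hRk0
  -- the limit viscosity is nonnegative
  have hν₀ : 0 ≤ ν₀ := ge_of_tendsto' hνlim hν
  rcases hν₀.eq_or_lt with hν0 | hνpos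
  · rw [← hν0, mul_zero, zero_mul]
    exact hRu0
  -- `ν₀ > 0`: weak lower semicontinuity against `2 (ν₀ - ε)` for every small `ε > 0`
  set I : ℝ := ∫ z, frobeniusNormSq (Gu z.1 z.2) * φ z.1 z.2 ∂μQ with hI
  have hI0 : 0 ≤ I := integral_nonneg fun z => mul_nonneg (frobeniusNormSq_nonneg _) (hφ0 _ _)
  suffices hmain : ∀ ε, 0 < ε → ε < ν₀ → 2 * (ν₀ - ε) * I ≤ Ru + ε by
    refine le_of_forall_pos_le_add fun δ hδ => ?_
    -- choose `ε` with `ε (1 + 2 I) ≤ δ` and `ε < ν₀`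
    set ε : ℝ := min (ν₀ / 2) (δ / (1 + 2 * I)) with hε
    have h12I : 0 < 1 + 2 * I := by positivity
    have hε0 : 0 < ε := lt_min (by positivity) (div_pos hδ h12I)
    have hεν : ε < ν₀ := (min_le_left _ _).trans_lt (by linarith)
    have hεδ : ε * (1 + 2 * I) ≤ δ := by
      have h := min_le_right (ν₀ / 2) (δ / (1 + 2 * I))
      rw [← hε] at h
      rwa [le_div_iff₀ h12I] at h
    have h := hmain ε hε0 hεν
    nlinarith [h, hεδ, hI0, hε0.le]
  intro ε hε hεν
  have h2ν : 0 < 2 * (ν₀ - ε) := by linarith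
  set B : ℝ≥0∞ := ENNReal.ofReal ((Ru + ε) / (2 * (ν₀ - ε))) with hB
  have hνev : ∀ᶠ k in atTop, ν₀ - ε < ν k :=
    (tendsto_order.1 hνlim).1 (ν₀ - ε) (by linarith)
  have hev : ∀ᶠ k in atTop, ∫⁻ z, ENNReal.ofReal (frobeniusNormSq (uncurry (G k) z) * uncurry φ z) ∂μQ
      ≤ B := by
    filter_upwards [(tendsto_order.1 hR).2 (Ru + ε) (lt_add_of_pos_right _ hε), hνev] with k hklt hνk
    have hint : Integrable (fun z : ℝ × E => frobeniusNormSq (G k z.1 z.2) * φ z.1 z.2) μQ := (hk k).1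
    have hnn : 0 ≤ᵐ[μQ] fun z : ℝ × E => frobeniusNormSq (G k z.1 z.2) * φ z.1 z.2 :=
      Eventually.of_forall fun z => mul_nonneg (frobeniusNormSq_nonneg _) (hφ0 _ _)
    have e := ofReal_integral_eq_lintegral_ofReal hint hnn
    change ∫⁻ z, ENNReal.ofReal (frobeniusNormSq (G k z.1 z.2) * φ z.1 z.2) ∂μQ ≤ B
    rw [← e, hB]
    refine ENNReal.ofReal_le_ofReal ?_
    rw [le_div_iff₀ h2ν, mul_comm]
    have hIk0 : 0 ≤ ∫ z, frobeniusNormSq (G k z.1 z.2) * φ z.1 z.2 ∂μQ :=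
      integral_nonneg fun z => mul_nonneg (frobeniusNormSq_nonneg _) (hφ0 _ _)
    calc 2 * (ν₀ - ε) * ∫ z, frobeniusNormSq (G k z.1 z.2) * φ z.1 z.2 ∂μQ
        ≤ 2 * ν k * ∫ z, frobeniusNormSq (G k z.1 z.2) * φ z.1 z.2 ∂μQ :=
          mul_le_mul_of_nonneg_right (by linarith [hνk]) hIk0
      _ ≤ R k := (hk k).2
      _ ≤ Ru + ε := hklt.le
  have hlsc := lintegral_frobeniusNormSq_mul_le_of_tendsto (μ := μQ) (G := fun k => uncurry (G k))
    (Gu := uncurry Gu) (φ := uncurry φ) (C := C) hGm hGum hGu2 hφm (fun z => hφ0 _ _)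
    (fun z => (le_abs_self _).trans ((Real.norm_eq_abs _).symm.le.trans (hφC z))) hGw hev
  -- back to real numbers
  have hnn : 0 ≤ᵐ[μQ] fun z : ℝ × E => frobeniusNormSq (Gu z.1 z.2) * φ z.1 z.2 :=
    Eventually.of_forall fun z => mul_nonneg (frobeniusNormSq_nonneg _) (hφ0 _ _)
  have e := ofReal_integral_eq_lintegral_ofReal hIGu hnn
  change ∫⁻ z, ENNReal.ofReal (frobeniusNormSq (Gu z.1 z.2) * φ z.1 z.2) ∂μQ ≤ B at hlsc
  rw [← e, hB, ENNReal.ofReal_le_ofReal_iff (div_nonneg (by linarith) h2ν.le)] at hlsc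
  rw [mul_comm, ← le_div_iff₀ h2ν]
  exact hlsc

/-- **The vanishing-viscosity case `ν_k → 0`**: under the hypotheses of
`isSuitableWeakSolutionOn_of_tendsto_viscosity` with `ν_k → 0`, the limit `(u, p)` is a suitable weak
EULER solution on `Q` (`ν = 0`, no force). [cite: BradshawTsai2019, §4.3 (proof of Thm 1.2)] -/
theorem isSuitableWeakSolutionOn_euler_of_tendsto_viscosity {Q : Opens (ℝ × E)}
    (hQ : volume (Q : Set (ℝ × E)) ≠ ∞) {ν : ℕ → ℝ} (hν : ∀ k, 0 ≤ ν k)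
    (hνlim : Tendsto ν atTop (𝓝 0))
    {v : ℕ → ℝ → E → E} {π : ℕ → ℝ → E → ℝ} {G : ℕ → ℝ → E → E →L[ℝ] E}
    {u : ℝ → E → E} {p : ℝ → E → ℝ} {Gu : ℝ → E → E →L[ℝ] E} {Cp : ℝ≥0∞} (hCp : Cp ≠ ∞)
    (hsol : ∀ k, IsSuitableWeakSolutionOn Q (ν k) 0 (v k) (π k))
    (hG : ∀ k, HasWeakSpatialGradientOn Q (v k) (G k))
    (hv3 : ∀ k, MemLp (uncurry (v k)) 3 (volume.restrict (Q : Set (ℝ × E))))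
    (hπb : ∀ k, ∫⁻ z in (Q : Set (ℝ × E)), ‖π k z.1 z.2‖ₑ ^ (3 / 2 : ℝ) ≤ Cp)
    (hu3 : MemLp (uncurry u) 3 (volume.restrict (Q : Set (ℝ × E))))
    (hpm : AEStronglyMeasurable (uncurry p) (volume.restrict (Q : Set (ℝ × E))))
    (hpb : ∫⁻ z in (Q : Set (ℝ × E)), ‖p z.1 z.2‖ₑ ^ (3 / 2 : ℝ) ≤ Cp)
    (hGu : HasWeakSpatialGradientOn Q u Gu)
    (hGu2 : ∫⁻ z in (Q : Set (ℝ × E)), ENNReal.ofReal (frobeniusNormSq (Gu z.1 z.2)) < ∞)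
    (huE : ∀ K ⊆ (Q : Set (ℝ × E)), IsCompact K → ∃ C : ℝ≥0, ∀ᵐ t : ℝ,
      ∫⁻ x, K.indicator (fun z : ℝ × E => ‖u z.1 z.2‖ₑ ^ 2) (t, x) ≤ C)
    (hconv : Tendsto (fun k => eLpNorm (uncurry (v k) - uncurry u) 3
      (volume.restrict (Q : Set (ℝ × E)))) atTop (𝓝 0))
    (hπw : ∀ g : ℝ × E → ℝ, MemLp g 3 (volume.restrict (Q : Set (ℝ × E))) →
      Tendsto (fun k => ∫ z in (Q : Set (ℝ × E)), π k z.1 z.2 * g z) atTop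
        (𝓝 (∫ z in (Q : Set (ℝ × E)), p z.1 z.2 * g z)))
    (hGw : ∀ (a : E) (h : ℝ × E → E), MemLp h 2 (volume.restrict (Q : Set (ℝ × E))) →
      Tendsto (fun k => ∫ z in (Q : Set (ℝ × E)), ⟪G k z.1 z.2 a, h z⟫) atTop
        (𝓝 (∫ z in (Q : Set (ℝ × E)), ⟪Gu z.1 z.2 a, h z⟫))) :
    IsSuitableWeakSolutionOn Q 0 0 u p :=
  isSuitableWeakSolutionOn_of_tendsto_viscosity hQ hν hνlim hCp hsol hG hv3 hπb hu3 hpm hpb hGu hGu2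
    huE hconv hπw hGw

end Summit.NavierStokesRegularity.NavierStokesRegularity.Theorems.SereginZoomReduction

end
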